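import Summits.RiemannHypothesis.RiemannHypothesis.Theorems.HardyZLehmerSplitDictionarystub_partialFraction
import Literature.NumberTheory.LFunctions.VinogradovKorobovFarZerosTail
import Literature.NumberTheory.LFunctions.FordZetaZeroRecipSqSum
import Literature.NumberTheory.LFunctions.ZetaZeroWindowsExplicit
import Literature.NumberTheory.LFunctions.SelbergDeltaAssembly
import Literature.NumberTheory.LFunctions.SoundZeroWindowSums
import Summits.RiemannHypothesis.RiemannHypothesis.Theorems.HardyZLehmerSplitDictionaryFarFieldSeriesHelper
import Summits.RiemannHypothesis.RiemannHypothesis.Theorems.HardyZLehmerSplitDictionaryKernelBoundHelper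
import HarnessLib

/-!
# Far-field shells for stub B of crux `Dictionary` (route `HardyZLehmerSplit`, stmt-RiemannHypothesis-24248)

Helper module for `stub_farField : ∀ t ≥ 100, |farSum t| ≤ 20 log t + 50`
(`Summit.RiemannHypothesis.RiemannHypothesis.Cruxes.Dictionary.DictionaryV1`).  Contents:
the differenced-kernel bound `|K(t,ρ)| ≤ (3/2)/(t−γ)²` for `|t−γ| ≥ 1`; absolute summability of
`farTerm t`; the negative-ordinate piece via Ford's `∑ m/|ρ|² ≤ 0.0463`; and the shell regrouping
infrastructure.  The Finset-of-subtype ↦ `zetaZeroCount` bridge is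
`Finset.map ⟨Subtype.val, _⟩` + `FarZeros.sum_le_zetaZeroCount_sub`; no subtype re-indexing of tsums.
Nothing here bears on the truth of RH.
-/

noncomputable section

open Complex Set Filter Topology Real BigOperators
open Literature.NumberTheory.LFunctions
open Literature.NumberTheory.LFunctions.SelbergDelta
open Summit.RiemannHypothesis.RiemannHypothesis.Theorems

namespace StubFarField

/-- Abbreviation for the subtype of non-trivial zeros of the Riemann zeta function. -/
abbrev Zeros := RHWave0.riemannZetaNontrivialZeros

/-! ## Kernel bound -/

/-- The imaginary part of the difference `1/(½+it-ρ) - 1/(2+it-ρ)` is bounded by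
`(3/2)/(t-γ)²` when `|t-γ| ≥ 1` for a non-trivial zero ρ.

Mathematically: |K(t,ρ)| = |Im[1/(½+it-ρ) - 1/(2+it-ρ)]| ≤ (3/2)/(t-γ)²
Proof: The difference equals (3/2)/[(½+it-ρ)(2+it-ρ)], each factor has norm ≥ |t-γ|. -/
lemma abs_kernel_le {t : ℝ} {ρ : ℂ} (hne : 1 ≤ |t - ρ.im|) :
    |kernel t ρ| ≤ 3 / 2 / (t - ρ.im) ^ 2 := by
  simp only [kernel, critPt, cmpPt]
  set w₁ := (1:ℂ)/2 + (t:ℂ)*I - ρ with hw₁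
  set w₂ := (2:ℂ) + (t:ℂ)*I - ρ with hw₂
  -- The imaginary parts are t - ρ.im
  have him1 : w₁.im = t - ρ.im := by simp [hw₁]
  have him2 : w₂.im = t - ρ.im := by simp [hw₂]
  -- w₁ ≠ 0 and w₂ ≠ 0 since |t - ρ.im| ≥ 1 > 0
  have hne1 : w₁ ≠ 0 := fun h ↦ by
    have : w₁.im = 0 := by rw [h]; simp
    rw [him1] at this; simp [this] at hne; linarith
  have hne2 : w₂ ≠ 0 := fun h ↦ by
    have : w₂.im = 0 := by rw [h]; simp
    rw [him2] at this; simp [this] at hne; linarith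
  -- Norm bounds: ‖w₁‖ ≥ |t - ρ.im|, ‖w₂‖ ≥ |t - ρ.im|
  have hn1 : |t - ρ.im| ≤ ‖w₁‖ := by
    calc |t - ρ.im| = |w₁.im| := by rw [him1]
      _ ≤ ‖w₁‖ := Complex.abs_im_le_norm w₁
  have hn2 : |t - ρ.im| ≤ ‖w₂‖ := by
    calc |t - ρ.im| = |w₂.im| := by rw [him2]
      _ ≤ ‖w₂‖ := Complex.abs_im_le_norm w₂
  have hgap : 0 < |t - ρ.im| := by linarith
  -- The algebraic identity: 1/w₁ - 1/w₂ = (w₂ - w₁)/(w₁·w₂) = (3/2)/(w₁·w₂)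
  have hdiff_num : w₂ - w₁ = (3:ℂ)/2 := by simp [hw₁, hw₂]; ring
  have hdiff : 1/w₁ - 1/w₂ = ((3:ℂ)/2) / (w₁ * w₂) := by
    rw [div_sub_div _ _ hne1 hne2]
    congr 1
    rw [one_mul, mul_one, hdiff_num]
  -- |Im(·)| ≤ ‖·‖
  have h1 : |(-(((3:ℂ)/2) / (w₁ * w₂)).im)| ≤ ‖((3:ℂ)/2) / (w₁ * w₂)‖ := by
    rw [abs_neg]; exact Complex.abs_im_le_norm _
  -- ‖(3/2)/(w₁·w₂)‖ = (3/2)/(‖w₁‖·‖w₂‖)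
  have h2 : ‖((3:ℂ)/2) / (w₁ * w₂)‖ = (3/2) / (‖w₁‖ * ‖w₂‖) := by
    rw [norm_div, norm_mul]
    congr 1
    simp only [norm_div, Complex.norm_ofNat]
  -- Put it all together
  have h3 : (3/2) / (‖w₁‖ * ‖w₂‖) ≤ (3/2) / (|t - ρ.im| * |t - ρ.im|) := by
    refine div_le_div_of_nonneg_left (by norm_num) (by positivity) ?_
    exact mul_le_mul hn1 hn2 hgap.le (by linarith)
  have h4 : |t - ρ.im| * |t - ρ.im| = (t - ρ.im)^2 := by rw [← sq_abs]; ring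
  have e1 : (-(((3:ℂ)/2) / (w₁ * w₂)).im) = (-((1/w₁ - 1/w₂).im)) := by rw [hdiff]
  calc |(-((1/w₁ - 1/w₂).im))|
      = |(-(((3:ℂ)/2) / (w₁ * w₂)).im)| := by rw [e1]
    _ ≤ ‖((3:ℂ)/2) / (w₁ * w₂)‖ := h1
    _ = (3/2) / (‖w₁‖ * ‖w₂‖) := h2
    _ ≤ (3/2) / (|t - ρ.im| * |t - ρ.im|) := h3
    _ = (3/2) / (t - ρ.im)^2 := by rw [h4]
    _ = 3 / 2 / (t - ρ.im)^2 := by ring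

/-- Weaker version with constant 2 instead of 3/2 (may be easier to use). -/
lemma abs_kernel_le' {t : ℝ} {ρ : ℂ} (hne : 1 ≤ |t - ρ.im|) :
    |kernel t ρ| ≤ 2 / (t - ρ.im) ^ 2 := by
  have h := abs_kernel_le hne
  have : (3 : ℝ) / 2 ≤ 2 := by norm_num
  calc |kernel t ρ| ≤ 3 / 2 / (t - ρ.im) ^ 2 := h
    _ ≤ 2 / (t - ρ.im) ^ 2 := div_le_div_of_nonneg_right this (sq_nonneg _)

/-! ## Negative ordinate bound -/

/-- For negative ordinates, the kernel is tiny: |kernel| ≤ 2/114² < 0.00016 for t ≥ 100. -/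
lemma kernel_bound_neg {t : ℝ} (ht : 100 ≤ t) {ρ : Zeros} (hneg : (ρ : ℂ).im < 0) :
    |kernel t ρ| ≤ 2 / 114 ^ 2 := by
  have h14 := FordL33.fourteen_lt_abs_im ρ
  rw [abs_of_neg hneg] at h14
  have hpos : 0 < t - (ρ : ℂ).im := by linarith
  have h1 : 1 ≤ |t - (ρ : ℂ).im| := by
    rw [abs_of_pos hpos]; linarith
  have h2 : 114 ≤ |t - (ρ : ℂ).im| := by
    rw [abs_of_pos hpos]
    linarith
  have hk := abs_kernel_le' h1
  have h3 : (t - (ρ : ℂ).im) ^ 2 ≥ 114 ^ 2 := by nlinarith [sq_nonneg (t - (ρ : ℂ).im)]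
  calc |kernel t ρ|
      ≤ 2 / (t - (ρ : ℂ).im) ^ 2 := hk
    _ ≤ 2 / 114 ^ 2 := by apply div_le_div_of_nonneg_left (by norm_num) (by norm_num) h3

/-! ## Summability -/

/-- For |t - γ| ≥ 1, we have 1/(t - γ)² ≤ 2/(1 + (t - γ)²). -/
lemma inv_sq_le_two_div_one_add_sq {x : ℝ} (hx : 1 ≤ |x|) :
    1 / x ^ 2 ≤ 2 / (1 + x ^ 2) := by
  have hx2 : 1 ≤ x ^ 2 := by nlinarith [sq_abs x]
  have h1 : 0 < x ^ 2 := by positivity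
  have h2 : 0 < 1 + x ^ 2 := by positivity
  rw [div_le_div_iff₀ h1 h2]
  nlinarith

/-- A non-trivial zero outside the window has |t - Im ρ| ≥ 1 (for t ≥ 1).
The window is `{ρ | 0 < Im ρ ∧ t-1 < Im ρ ≤ t+1}`, so outside means:
  - Im ρ ≤ 0 (⇒ |t - Im ρ| ≥ t ≥ 1), or
  - Im ρ > 0 ∧ Im ρ ≤ t-1 (⇒ |t - Im ρ| ≥ 1), or
  - Im ρ > 0 ∧ Im ρ > t+1 (⇒ |t - Im ρ| > 1). -/
lemma not_mem_window_imp_abs_sub_ge_one {t : ℝ} (ht : 1 ≤ t) {ρ : Zeros} (hmem : (ρ : ℂ) ∉ window t) :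
    1 ≤ |t - (ρ : ℂ).im| := by
  have hz := ZetaZeros.riemannZetaNontrivialZeros.zeta_eq_zero ρ.2
  have hre0 := (ZetaZeros.riemannZetaNontrivialZeros.re_pos ρ.2).le
  have hre1 := (ZetaZeros.riemannZetaNontrivialZeros.re_lt_one ρ.2).le
  by_cases him0 : (ρ : ℂ).im ≤ 0
  · -- Case: Im ρ ≤ 0, so |t - Im ρ| = t - Im ρ ≥ t ≥ 1
    have h : t - (ρ : ℂ).im ≥ t := by linarith
    rw [abs_of_nonneg (by linarith)]
    linarith
  · push Not at him0
    -- Case: Im ρ > 0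
    by_cases h_in_upper : (ρ : ℂ).im ≤ t + 1
    · -- Case: 0 < Im ρ ≤ t + 1
      -- Since ρ ∉ window, and Im ρ > 0, Im ρ ≤ t + 1, we must have Im ρ ≤ t - 1
      have h_upper : (ρ : ℂ) ∈ zetaZeroBox 0 (t + 1) := ⟨hz, hre0, hre1, him0, h_in_upper⟩
      have h_not_in_window : (ρ : ℂ) ∉ window t := hmem
      simp only [window, Set.mem_sdiff] at h_not_in_window
      have : ¬((ρ : ℂ) ∈ zetaZeroBox 0 (t + 1) ∧ (ρ : ℂ) ∉ zetaZeroBox 0 (t - 1)) := h_not_in_window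
      push Not at this
      have h_in_lower := this h_upper
      -- h_in_lower : ρ ∈ zetaZeroBox 0 (t - 1)
      simp only [zetaZeroBox, mem_setOf_eq] at h_in_lower
      have h_im_le : (ρ : ℂ).im ≤ t - 1 := h_in_lower.2.2.2.2
      rw [abs_of_nonneg (by linarith)]
      linarith
    · -- Case: Im ρ > t + 1, so |t - Im ρ| = Im ρ - t > 1
      push Not at h_in_upper
      rw [abs_of_neg (by linarith)]
      linarith

/-- The farTerm is summable: comparison with the Ford-summable 1/(1 + (γ - t)²). -/
lemma summable_abs_farTerm {t : ℝ} (ht : 1 ≤ t) : Summable fun ρ : Zeros => |farTerm t ρ| := by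
  refine Summable.of_nonneg_of_le (fun _ => abs_nonneg _) ?_
    (summable_zeroOrder_div_one_add_sub_sq t |>.mul_left 4)
  intro ρ
  simp only [farTerm]
  by_cases hmem : (ρ : ℂ) ∈ window t
  · simp only [hmem, ↓reduceIte, abs_zero]
    apply mul_nonneg (by norm_num : (0 : ℝ) ≤ 4)
    apply div_nonneg
    · exact_mod_cast riemannZetaZeroOrder_nonneg (ZetaZeros.riemannZetaNontrivialZeros.ne_one ρ.2)
    · positivity
  · simp only [hmem, ↓reduceIte]
    have hfar := not_mem_window_imp_abs_sub_ge_one ht hmem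
    have hm : (0 : ℝ) ≤ riemannZetaZeroOrder (ρ : ℂ) := by
      exact_mod_cast riemannZetaZeroOrder_nonneg (ZetaZeros.riemannZetaNontrivialZeros.ne_one ρ.2)
    have hk := abs_kernel_le' hfar
    have hbound : |(riemannZetaZeroOrder (ρ : ℂ) : ℝ) * kernel t ρ|
        ≤ (riemannZetaZeroOrder (ρ : ℂ) : ℝ) * (2 / (t - (ρ : ℂ).im) ^ 2) := by
      rw [abs_mul, abs_of_nonneg hm]
      exact mul_le_mul_of_nonneg_left hk hm
    have hinv := inv_sq_le_two_div_one_add_sq hfar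
    calc |(riemannZetaZeroOrder (ρ : ℂ) : ℝ) * kernel t ρ|
        ≤ (riemannZetaZeroOrder (ρ : ℂ) : ℝ) * (2 / (t - (ρ : ℂ).im) ^ 2) := hbound
      _ ≤ (riemannZetaZeroOrder (ρ : ℂ) : ℝ) * (4 / (1 + (t - (ρ : ℂ).im) ^ 2)) := by
          refine mul_le_mul_of_nonneg_left ?_ hm
          calc 2 / (t - (ρ : ℂ).im) ^ 2
              = 2 * (1 / (t - (ρ : ℂ).im) ^ 2) := by ring
            _ ≤ 2 * (2 / (1 + (t - (ρ : ℂ).im) ^ 2)) :=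
                mul_le_mul_of_nonneg_left hinv (by norm_num)
            _ = 4 / (1 + (t - (ρ : ℂ).im) ^ 2) := by ring
      _ = 4 * ((riemannZetaZeroOrder (ρ : ℂ) : ℝ) / (1 + ((ρ : ℂ).im - t) ^ 2)) := by
          rw [show t - (ρ : ℂ).im = -((ρ : ℂ).im - t) by ring, neg_sq]; ring

/-- The farSum converges absolutely. -/
lemma summable_farTerm {t : ℝ} (ht : 1 ≤ t) : Summable (farTerm t) :=
  Summable.of_norm (summable_abs_farTerm ht)

/-! ## Finite sum bounds for shell decomposition -/

/-- For zeros with negative ordinate (γ < 0), bound the finite sum using Ford's bound.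
    Sum ≤ (8/3) * ∑ m/|ρ|² ≤ (8/3) * 0.0463 < 0.124. -/
lemma finset_sum_neg_le {t : ℝ} (ht : 100 ≤ t) (S : Finset Zeros)
    (hS : ∀ ρ ∈ S, (ρ : ℂ).im < 0) :
    ∑ ρ ∈ S, |farTerm t ρ| ≤ 0.124 := by
  have hbd : ∀ ρ ∈ S, |farTerm t ρ| ≤
      (8 / 3) * ((riemannZetaZeroOrder (ρ : ℂ) : ℝ) / ‖(ρ : ℂ)‖ ^ 2) := by
    intro ρ hρ
    have hγ : (ρ : ℂ).im < 0 := hS ρ hρ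
    have h14 := FordL33.fourteen_lt_abs_im ρ
    rw [abs_of_neg hγ] at h14
    have hm : (0 : ℝ) ≤ riemannZetaZeroOrder (ρ : ℂ) := by
      exact_mod_cast riemannZetaZeroOrder_nonneg (ZetaZeros.riemannZetaNontrivialZeros.ne_one ρ.2)
    have hnotwin : (ρ : ℂ) ∉ window t := by
      simp only [window, Set.mem_sdiff, not_and, not_not]
      intro h; simp only [zetaZeroBox, Set.mem_setOf_eq] at h; linarith [h.2.2.2.1]
    simp only [farTerm, hnotwin, ↓reduceIte, abs_mul, abs_of_nonneg hm]
    have hne : 1 ≤ |t - (ρ : ℂ).im| := by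
      have : t - (ρ : ℂ).im > 114 := by linarith
      rw [abs_of_pos (by linarith)]; linarith
    have hk := abs_kernel_le' hne
    have htγ_ge : (t - (ρ : ℂ).im) ^ 2 ≥ (ρ : ℂ).im ^ 2 := by nlinarith
    have hγ2_pos : 0 < (ρ : ℂ).im ^ 2 := by nlinarith
    have hρ_sq_bound : ‖(ρ : ℂ)‖ ^ 2 ≤ (4 / 3) * (ρ : ℂ).im ^ 2 := by
      have hre := ZetaZeros.riemannZetaNontrivialZeros.re_pos ρ.2
      have hre1 := ZetaZeros.riemannZetaNontrivialZeros.re_lt_one ρ.2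
      calc ‖(ρ : ℂ)‖ ^ 2 = Complex.normSq (ρ : ℂ) := Complex.sq_norm _
        _ = (ρ : ℂ).re ^ 2 + (ρ : ℂ).im ^ 2 := by simp [Complex.normSq_apply]; ring
        _ ≤ 1 + (ρ : ℂ).im ^ 2 := by nlinarith
        _ ≤ (4 / 3) * (ρ : ℂ).im ^ 2 := by nlinarith
    have hρ_pos : 0 < ‖(ρ : ℂ)‖ ^ 2 := by
      have hρ_ne : (ρ : ℂ) ≠ 0 := by
        intro h
        have hre := ZetaZeros.riemannZetaNontrivialZeros.re_pos ρ.2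
        simp only [h, Complex.zero_re] at hre
        linarith
      have : ‖(ρ : ℂ)‖ ≠ 0 := norm_ne_zero_iff.mpr hρ_ne
      positivity
    have h_kern_γ : 2 / (t - (ρ : ℂ).im) ^ 2 ≤ 2 / (ρ : ℂ).im ^ 2 :=
      div_le_div_of_nonneg_left (by norm_num) hγ2_pos htγ_ge
    have h_div_bound : 2 / (ρ : ℂ).im ^ 2 ≤ (8 / 3) / ‖(ρ : ℂ)‖ ^ 2 := by
      rw [div_le_div_iff₀ hγ2_pos hρ_pos]; nlinarith
    calc (riemannZetaZeroOrder (ρ : ℂ) : ℝ) * |kernel t ρ|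
        ≤ (riemannZetaZeroOrder (ρ : ℂ) : ℝ) * (2 / (t - (ρ : ℂ).im) ^ 2) :=
          mul_le_mul_of_nonneg_left hk hm
      _ ≤ (riemannZetaZeroOrder (ρ : ℂ) : ℝ) * (2 / (ρ : ℂ).im ^ 2) :=
          mul_le_mul_of_nonneg_left h_kern_γ hm
      _ ≤ (riemannZetaZeroOrder (ρ : ℂ) : ℝ) * ((8 / 3) / ‖(ρ : ℂ)‖ ^ 2) :=
          mul_le_mul_of_nonneg_left h_div_bound hm
      _ = (8 / 3) * ((riemannZetaZeroOrder (ρ : ℂ) : ℝ) / ‖(ρ : ℂ)‖ ^ 2) := by ring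
  calc ∑ ρ ∈ S, |farTerm t ρ|
      ≤ ∑ ρ ∈ S, (8 / 3) * ((riemannZetaZeroOrder (ρ : ℂ) : ℝ) / ‖(ρ : ℂ)‖ ^ 2) :=
        Finset.sum_le_sum hbd
    _ = (8 / 3) * ∑ ρ ∈ S, (riemannZetaZeroOrder (ρ : ℂ) : ℝ) / ‖(ρ : ℂ)‖ ^ 2 := by
        rw [← Finset.mul_sum]
    _ ≤ (8 / 3) * 0.0463 := by gcongr; exact sum_zeroOrder_div_norm_sq_le S
    _ ≤ 0.124 := by norm_num

/-- Shell index: ⌊|t - γ|⌋ for zeros outside the window. -/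
noncomputable def shellIndex (t : ℝ) (ρ : Zeros) : ℕ := ⌊|t - (ρ : ℂ).im|⌋₊

/-- For zeros in shell n ≥ 1, the kernel is bounded by (3/2)/n². -/
lemma kernel_shell_bound {t : ℝ} {ρ : Zeros} {n : ℕ} (hn : 1 ≤ n)
    (hshell : shellIndex t ρ = n) :
    |kernel t ρ| ≤ 3 / 2 / (n : ℝ) ^ 2 := by
  have hfloor : (n : ℝ) ≤ |t - (ρ : ℂ).im| := by
    rw [← hshell]; exact Nat.floor_le (abs_nonneg _)
  have hn_pos : (0 : ℝ) < n := Nat.cast_pos.mpr (Nat.pos_of_ne_zero (Nat.one_le_iff_ne_zero.mp hn))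
  have habs_ge : 1 ≤ |t - (ρ : ℂ).im| := by
    have h1n : (1 : ℝ) ≤ n := Nat.one_le_cast.mpr hn
    linarith
  have hk := abs_kernel_le habs_ge
  have hsq : (n : ℝ) ^ 2 ≤ (t - (ρ : ℂ).im) ^ 2 := by
    have := sq_abs (t - (ρ : ℂ).im)
    nlinarith [sq_nonneg ((n : ℝ) - |t - (ρ : ℂ).im|)]
  calc |kernel t ρ|
      ≤ 3 / 2 / (t - (ρ : ℂ).im) ^ 2 := hk
    _ ≤ 3 / 2 / (n : ℝ) ^ 2 := div_le_div_of_nonneg_left (by norm_num) (by positivity) hsq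

/-! ## Shell regrouping (inline) -/

/-- **Weighted shell regrouping.** For finite sum with weights `w i ≤ m i * K (shell i)` and
fibre multiplicity bounds `∑_{shell i = n} m i ≤ c n`, we have `∑ w ≤ ∑_{n < N} c n * K n`. -/
lemma finset_sum_le_shell_bound_mul {ι : Type*} (u : Finset ι) (shell : ι → ℕ) (w m : ι → ℝ)
    (K c : ℕ → ℝ) (N : ℕ)
    (hw : ∀ i ∈ u, w i ≤ m i * K (shell i))
    (hK : ∀ n, 0 ≤ K n)
    (hc : ∀ n, ∑ i ∈ u.filter (fun i => shell i = n), m i ≤ c n)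
    (hN : ∀ i ∈ u, shell i < N) :
    ∑ i ∈ u, w i ≤ ∑ n ∈ Finset.range N, c n * K n := by
  have hmaps : ∀ i ∈ u, shell i ∈ Finset.range N := fun i hi => Finset.mem_range.mpr (hN i hi)
  rw [← Finset.sum_fiberwise_of_maps_to hmaps]
  apply Finset.sum_le_sum
  intro n _
  calc ∑ i ∈ u.filter (fun i => shell i = n), w i
      ≤ ∑ i ∈ u.filter (fun i => shell i = n), m i * K n := by
        apply Finset.sum_le_sum
        intro i hi
        rw [Finset.mem_filter] at hi
        rw [← hi.2]
        exact hw i hi.1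
    _ = (∑ i ∈ u.filter (fun i => shell i = n), m i) * K n := by rw [Finset.sum_mul]
    _ ≤ c n * K n := mul_le_mul_of_nonneg_right (hc n) (hK n)


/-- Any finite family meets only shells below `u.sup shell + 1` (director's spec `ShellRegroup`). -/
lemma shell_lt_sup_succ {ι : Type*} (u : Finset ι) (shell : ι → ℕ) :
    ∀ i ∈ u, shell i < u.sup shell + 1 :=
  fun _ hi => Nat.lt_succ_of_le (Finset.le_sup (f := shell) hi)

/-- A partial sum of `1/n²` is at most `2`. -/
lemma sum_range_one_div_sq_le_two (N : ℕ) : ∑ n ∈ Finset.range N, (1 : ℝ) / (n : ℝ) ^ 2 ≤ 2 :=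
  le_trans (DictionaryFarFieldSeries.summable_one_div_sq.sum_le_tsum _ fun n _ => by positivity)
    tsum_one_div_sq_le_two

/-- A partial sum of `log(t+n+2)/n²` (`n ≥ 1`) is at most `2 log t + 10` (`t ≥ 100`). -/
lemma sum_range_log_div_sq_le {t : ℝ} (ht : 100 ≤ t) (N : ℕ) :
    ∑ n ∈ Finset.range N, (if n = 0 then (0 : ℝ) else Real.log (t + n + 2) / (n : ℝ) ^ 2) ≤
      2 * Real.log t + 10 := by
  have ht1 : 1 ≤ t := by linarith
  refine le_trans ((DictionaryFarFieldSeries.summable_log_add_div_sq ht1).sum_le_tsum _ fun n _ => ?_)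
    (DictionaryFarFieldSeries.series_log_div_sq_le t ht)
  by_cases hn : n = 0
  · simp [hn]
  · simp only [hn, ↓reduceIte]
    have h1 : (1 : ℝ) ≤ t + n + 2 := by linarith [Nat.cast_nonneg (α := ℝ) n]
    exact div_nonneg (Real.log_nonneg h1) (sq_nonneg _)

/-! ## Bridge: a finite family of subtype zeros in an ordinate window `(T₁, T₂]` has multiplicity `≤ N(T₂) − N(T₁)` -/

/-- **Finset-of-subtype ↦ `zetaZeroCount` bridge.** -/
lemma sum_order_le_count_sub {T₁ T₂ : ℝ} (h₁ : 0 ≤ T₁) (h12 : T₁ ≤ T₂) (F : Finset Zeros)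
    (hF : ∀ ρ ∈ F, T₁ < (ρ : ℂ).im ∧ (ρ : ℂ).im ≤ T₂) :
    ∑ ρ ∈ F, (riemannZetaZeroOrder (ρ : ℂ) : ℝ) ≤ (zetaZeroCount T₂ : ℝ) - zetaZeroCount T₁ := by
  classical
  have hsum : ∑ ρ ∈ F, (riemannZetaZeroOrder (ρ : ℂ) : ℝ) =
      ∑ z ∈ F.map ⟨Subtype.val, Subtype.val_injective⟩, (riemannZetaZeroOrder z : ℝ) := by
    rw [Finset.sum_map]; rfl
  rw [hsum]
  refine FarZeros.sum_le_zetaZeroCount_sub h₁ h12 _ fun z hz => ?_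
  rw [Finset.mem_map] at hz
  obtain ⟨ρ, hρ, rfl⟩ := hz
  exact ⟨ZetaZeros.riemannZetaNontrivialZeros.zeta_eq_zero ρ.2, hF ρ hρ⟩

end StubFarField
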